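import Mathlib
import Summits.NavierStokesRegularity.NavierStokesRegularity.Theses.LoopPeriodRatchet
import HarnessLib

/-!
# `LoopPeriodRatchet.Assembly` — the route's assembly (item stmt-NavierStokesRegularity-22496; pure logic)

**Statement.** `PeriodRatchet → PeriodScalingBound → OpenLoopLiouville → NoLoopsOfRatchet →
PoloidalWindowDoor.Target`.

PROOF. The route file carries the planner-authored, kernel-checked deciding theorem
`Theses.LoopPeriodRatchet.closes` with exactly these hypotheses and the rung leaf
`PoloidalWindowDoor.Target` as conclusion; the assembly is its curried form. An IMPLICATION only:
the hypotheses (among them the open cruxes `PeriodRatchet`, `OpenLoopLiouville`) remain hypotheses.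

HONEST FRAMING: pure logic between the route's own statements; no rung and no summit is proved here.
-/

noncomputable section

set_option linter.dupNamespace false

namespace Summit.NavierStokesRegularity.NavierStokesRegularity.Theorems

open Summit.NavierStokesRegularity.NavierStokesRegularity.Theses.LoopPeriodRatchet in
/-- **Item stmt-NavierStokesRegularity-22496** (`LoopPeriodRatchet.Assembly`): the route's two cruxes and
two supports imply the rung leaf `PoloidalWindowDoor.Target`, by the route file's deciding theorem
`closes` (an implication; its hypotheses stay hypotheses). [this file] -/
theorem loopPeriodRatchet_assembly_proof :
    Summit.NavierStokesRegularity.NavierStokesRegularity.Theses.LoopPeriodRatchet.Assembly := by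
  unfold Summit.NavierStokesRegularity.NavierStokesRegularity.Theses.LoopPeriodRatchet.Assembly
  -- (buildfix 2026-08-28) the route's `closes` was re-keyed (12:56Z) to `FrequencyGrowthExponent` /
  -- `NoLoopsOfGrowth`; this CLOSED assembly keeps its accepted statement over `PeriodRatchet` /
  -- `NoLoopsOfRatchet`, so the pre-edit chain of `closes` is inlined verbatim: no-loops from the ratchet
  -- fed to the open-loop Liouville crux, then the `PoloidalWindowDoor` rung's deciding theorem.
  intro h₁ h₂ h₃ h₄
  exact Summit.NavierStokesRegularity.NavierStokesRegularity.Theses.PoloidalWindowDoor.closes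
    Summit.NavierStokesRegularity.NavierStokesRegularity.Theorems.PoloidalWindowDoorLocalPointZoomSlices.localPointZoomSlices_proof
    (Summit.NavierStokesRegularity.NavierStokesRegularity.Theorems.PoloidalWindowDoorPoloidalWindowRigidity.poloidalWindowRigidity_of_nonflatLiouville
      (fun C v hr hc hm hd hpol hfro hnf =>
        h₃ C v hr hc hm hd hpol hfro hnf (h₄ h₁ h₂ C v hr hc hm hd hpol)))

end Summit.NavierStokesRegularity.NavierStokesRegularity.Theorems

end
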